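/-
Copyright (c) 2026 the pub-hodgecm-mathlib formalisation cell (harness21).  Track B «K2-LIT» prover seat hodgecm-mathlib-K2E4-p14 (g4), 2026-09-04:
‹S› ROAD J, road (d-w) of K2E3-p03 (g3), brick (C2b-ii) FILE B — THE CM DRESS: `[S ∩ K_an : S ∩ K_an(4)] = q^{6m−⌊d∕2⌋}` on the carrier `U(⟨1,−ξ⟩)(L⁺_v)` in `levelOf` currency.
-/
import Summits.HodgeConjecture.HodgeConjecture.Theorems.K2E3WildOrderNormOneLevelCount     -- ★ FILE A2b (this seat): `relIndex_normOne_level_eq_pow_of_injective` (+ ★ A1∕A1b∕A2a)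
import Summits.HodgeConjecture.HodgeConjecture.Theorems.K2E3WildAnisotropicPlaneIndex      -- ★ K2E5-p16 (g3): `exists_isRamifiedQuadraticDatum_of_hd` (+ ★ NonIntegral: `exists_valued_eq_exp_neg_one`, `valued_two_lt_one_of_two_mem`)
import Summits.HodgeConjecture.HodgeConjecture.Theorems.K2E3WildIwahoriLevelCount           -- ★ K2E4-p09 (g3) (C1-I): `one_le_of_valued_two_eq`, ★ `valued_four_eq_of_ramified`, ★ `resChar_eq_two_of_mem`, the `Ψ = (↑) ∘ E` transport pattern
import Literature.NumberTheory.Rogawski1990.UnitaryLatticeTreeTameRamifiedCM               -- ★ `natCard_valuedResidueField_eq_of_ramified_CM` (`#𝓀[L_w] = #(𝓞_{L⁺}∕v)` at a ramified place)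
import Literature.NumberTheory.Automorphic.RamifiedPlaceDifferent                         -- ★ `valued_two_eq_sq_of_ramified` (`|2|_w = |2|_v²`)
import Literature.NumberTheory.Weil1982.UnitaryFinTopFormUnimodularLieLattice              -- ★ `levelOf_ballMat_le_inf_level` (`levelOf 1 (a·M) ≤ Z(1) ⊓ K_v`)
import Literature.NumberTheory.Weil1982.UnitaryFinTopFormLevelOneGoodPlace                 -- ★ `mat_inv_sub_one_mem_ballMat` (the inverse half of the `levelOf` letter on `K_v`)
import HarnessLib

/-!
# (C2b-ii) «`[S ∩ K_an : S ∩ K_an(4)] = q^{6m−⌊d∕2⌋}`» ON THE CM CARRIER — the `levelOf` ∕ one-place-model dress of ★ `K2E3WildOrderNormOneLevelCount`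
# (Kottwitz 1988 §1; Riehm 1970; Serre, *Local Fields* V §3; Rogawski 1990 §3.8)

Cell `pub/hodgecm-mathlib`, Track B «K2-LIT», crux H413 = `stmt-HodgeConjecture-24833` (supports-only, `--as helper`, count-neutral); ‹S› ROAD J, road (d-w) of ‹J3› v2 (owner
K2E3-p03 (g3)); letter (C2) `sig_K2E3WildAnisotropicResidualCount` ⟸ ★ K2E5-p07 (g3) `K2E3WildAnisotropicResidualCountOfParts.anCount_of_struct_of_topIndex_of_ladder (hS) (hTop) (hLad)`;
THIS FILE PAYS `hLad` = brick **(C2b-ii)** (road owner 03:36:47Z (2), dealer K2E3-plan (g3) 03:38:10Z (R2)) BY NAME: `relIndex_levelOf_inf_normOne_eq_pow` has EXACTLY the closer's `hLad`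
binder type (∀-closed over the place data; `d` by the `∀ τ` different letter; `S` = K2E5-p16 (g3)'s det-one binder through ★ `localNonsplitEquiv`; `q = #(𝓞_{L⁺} ∕ v)`).  THEOREMS ONLY.

THE MATHEMATICS is ★ `K2E3WildOrderNormOneLevelCount.relIndex_normOne_level_eq_pow_of_injective` (datum currency: `[Λ¹ : Λ¹ ∩ (1+4Λ)] = q^{6m−⌊d∕2⌋}` for the norm-one group `Λ¹` of the
order `Λ = 𝒪_w ⊕ 𝒪_w·j` of the anisotropic plane, via `[Λ¹ : Λ¹ ∩ N]·[nrd Λ^× : nrd N] = [Λ^× : N]`, residue counting, ★ trace depth and ★ Serre's `ψ`).  HERE (§1–§2) the two CM tokens are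
transported along the injective homomorphism `Ψ = (↑) ∘ E`, `E = localNonsplitEquiv` the one-place model `U(⟨1,−ξ⟩)(L⁺_v) ≃ U(σ_w, ⟨1,−ξ_w⟩)(L_w) ≤ GL₂(L_w)` (pattern of ★ p857189 (C1-I)):
* `Ψ(S ⊓ K_v)` = the norm-one order group `{[[a, ξσc],[c, σa]] : a, c ∈ 𝒪_w, det = 1}` — ★ Rogawski's dictionary `mem_unitaryGroupOfForm_and_det_eq_one_iff` (`SU(⟨1,−ξ⟩) = D¹`) + ★
  `mem_localIntegralLevel_iff_of_smul_eq` ∕ `mem_glInt_iff_forall_v_le_one_of_v_det_eq_one` (integrality at the unique place `w`);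
* `Ψ(levelOf 1 (p·M) ⊓ S)` = its level `{|a − 1|, |c| ≤ |4|_w = exp(−4m)}` — the `levelOf` letter `mat g − 1 ∈ 2·(p·M)` read entrywise at `w` with `p = resChar = 2` (§1
  `sub_one_mem_twoBall_ballMat_iff`, the `⟨1,−ξ⟩`-twin of ★ p857189 §1), ★ `valued_four_eq_of_ramified`, the inverse half by ★ `mat_inv_sub_one_mem_ballMat`;
* the datum: ★ `exists_isRamifiedQuadraticDatum_of_hd` (`d` prescribed), `t = 2m` from `|2|_w = |2|_v² = exp(−2m)`, `m ≥ 1` at a dyadic place; `#𝓀[L_w] = #(𝓞_{L⁺}∕v)` (★ ramified, `f = 1`).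
HONEST LABEL: HC_CM is proved only modulo the 7 printed citations (2 remaining named inputs: hLiu418 = `stmt-HodgeConjecture-24832`, h413 = `stmt-HodgeConjecture-24833`) until rung 0
closes; count-neutral helper; (C2b-ii) is ★ here, (C2)∕(C-ratio)∕(W3)∕‹J3› are NOT proved in this file (they follow by the dealer's re-tie through ★ K2E5-p07's closer once (C2b-i) lands).

## References
* [Kottwitz1988] R. E. Kottwitz, *Tamagawa numbers*, Ann. of Math. 127 (1988), §1 Thm. 1 (the place-freeness (C2) expresses).
* [Riehm1970] C. Riehm, *The norm 1 group of a 𝔭-adic division algebra*, Amer. J. Math. 92 (1970), §§1–2.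
* [Serre1979] J.-P. Serre, *Local Fields*, GTM 67 (1979), Ch. V §3 Prop. 5, Cor. 3; Ch. IV §2 Prop. 6.
* [Rogawski1990] J. D. Rogawski, *Automorphic Representations of Unitary Groups in Three Variables*, Ann. of Math. Stud. 123 (1990), §3.8 p. 33 (`SU(⟨1,−ξ⟩) = D¹`).
* [PlatonovRapinchuk1994] V. Platonov, A. Rapinchuk, *Algebraic Groups and Number Theory* (1994), §3.3, §5.1 (congruence subgroups, one-place models).
-/

set_option autoImplicit false
set_option linter.dupNamespace false

noncomputable section

open NumberField IsDedekindDomain Matrix WithZero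
open Literature.NumberTheory.Automorphic Literature.NumberTheory.Automorphic.UnitaryGroup Literature.NumberTheory.Weil1982.UnitaryFinTopForm
open Summit.HodgeConjecture.HodgeConjecture.Cruxes.H413.K2E3WildOrderUnitGroup
open Summit.HodgeConjecture.HodgeConjecture.Cruxes.H413.K2E3WildOrderNormOneLevelCount
open Summit.HodgeConjecture.HodgeConjecture.Cruxes.H413.K2E3WildAnisotropicPlaneIndex (exists_isRamifiedQuadraticDatum_of_hd)
open Summit.HodgeConjecture.HodgeConjecture.Cruxes.H413.K2E3WildIwahoriLevelCount (one_le_of_valued_two_eq)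
open scoped MatrixGroups Matrix Valued

namespace Summit.HodgeConjecture.HodgeConjecture.Cruxes.H413.K2E3WildOrderNormOneLevelCountPlace

variable (L : Type) [Field L] [NumberField L] [IsCMField L] (v : HeightOneSpectrum (𝓞 ↥(maximalRealSubfield L)))
  (w : PlacesOver L v) (hw : IsCMField.complexConj L • w.1 = w.1)

/-! ## §1 The `levelOf` letter at depth `4`, entrywise at `w`, for a general rank-two form -/

include hw in
/-- **THE `levelOf` LETTER AT DEPTH `4`, ENTRYWISE** (any `H`): for `g ∈ U(H)(L⁺_v)` at a dyadic place (`p = resChar = 2`), `mat g − 1 ∈ 2·(p·M₂(𝒪_{E_v}))` iff every entry of `E g − 1`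
has `|·|_w ≤ |4|_w` (`w` the only place over `v`; the `⟨1,−ξ⟩`-twin of ★ p857189 §1, same proof). [cite: PlatonovRapinchuk1994, §3.3, §5.1] -/
theorem sub_one_mem_twoBall_ballMat_iff (h2 : (2 : 𝓞 ↥(maximalRealSubfield L)) ∈ v.asIdeal) (H : Matrix (Fin 2) (Fin 2) L) (g : (cmDatum L 2 H).Local v) :
    mat L 2 H v g - 1 ∈ twoBall L 2 v (ballMat L 2 v ((resChar L v : ℕ) : LocalRing L v)) ↔
      ∀ i j, Valued.v ((((((localNonsplitEquiv (IsCMField.complexConj L) H (IsCMField.complexConj_ne_one L) w hw) g :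
          ↥(unitaryGroupOfForm (galAdicCompletionMap (L := L) (IsCMField.complexConj L) hw) (placeForm H w.1))) :
          GL (Fin 2) (w.1.adicCompletion L)) : Matrix (Fin 2) (Fin 2) (w.1.adicCompletion L)) i j) - (1 : Matrix (Fin 2) (Fin 2) (w.1.adicCompletion L)) i j) ≤ Valued.v (4 : w.1.adicCompletion L) := by
  classical
  haveI := PlacesOver.subsingleton_of_smul_eq (IsCMField.complexConj L) (IsCMField.complexConj_ne_one L) w hw
  have hp : resChar L v = 2 := K2E5BetaDetImageLevel.resChar_eq_two_of_mem L v h2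
  have hent : ∀ i j, (((((localNonsplitEquiv (IsCMField.complexConj L) H (IsCMField.complexConj_ne_one L) w hw) g :
      ↥(unitaryGroupOfForm (galAdicCompletionMap (L := L) (IsCMField.complexConj L) hw) (placeForm H w.1))) :
      GL (Fin 2) (w.1.adicCompletion L)) : Matrix (Fin 2) (Fin 2) (w.1.adicCompletion L)) i j) = mat L 2 H v g i j w := fun i j => by
    rw [coe_localNonsplitEquiv_apply, Matrix.map_apply, mat_def]; rfl
  have hone : ∀ i j : Fin 2, (1 : Matrix (Fin 2) (Fin 2) (LocalRing L v)) i j w = (1 : Matrix (Fin 2) (Fin 2) (w.1.adicCompletion L)) i j := fun i j => by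
    rw [Matrix.one_apply, Matrix.one_apply]; split_ifs <;> rfl
  have h40 : (4 : w.1.adicCompletion L) ≠ 0 := by
    haveI : CharZero (w.1.adicCompletion L) := charZero_of_injective_algebraMap (algebraMap L _).injective
    norm_num
  have hpw : ∀ w' : PlacesOver L v, ((resChar L v : ℕ) : LocalRing L v) w' = 2 := fun w' => by rw [Pi.natCast_apply, hp, Nat.cast_ofNat]
  constructor
  · intro h i j
    obtain ⟨X, hX, hX2⟩ := (mem_twoBall_iff L 2 v _ _).1 h
    obtain ⟨Y, hY, rfl⟩ := (mem_ballMat_iff L 2 v _ _).1 hX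
    have hYij : Valued.v (Y i j w) ≤ 1 := (mem_localIntegers_rankOne_iff L v w hw _).1 ((mem_intMatrices_iff L 2 v Y).1 hY i j)
    have hentry := congrFun (congrFun (congrFun hX2 i) j) w
    simp only [Matrix.smul_apply, smul_eq_mul, Pi.mul_apply, Matrix.sub_apply, Pi.sub_apply, hpw, Pi.ofNat_apply] at hentry
    rw [hent, ← hone, ← hentry, show (2 : w.1.adicCompletion L) * (2 * Y i j w) = 4 * Y i j w by ring, map_mul]
    exact mul_le_of_le_one_right' hYij
  · intro h
    let Y : Matrix (Fin 2) (Fin 2) (LocalRing L v) := fun i j w' => (mat L 2 H v g - 1) i j w' / 4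
    have hYw : ∀ i j (w' : PlacesOver L v), Y i j w' = (mat L 2 H v g - 1) i j w' / 4 := fun _ _ _ => rfl
    refine (mem_twoBall_iff L 2 v _ _).2 ⟨((resChar L v : ℕ) : LocalRing L v) • Y, (mem_ballMat_iff L 2 v _ _).2 ⟨Y, (mem_intMatrices_iff L 2 v Y).2 fun i j => ?_, rfl⟩, ?_⟩
    · refine (mem_localIntegers_rankOne_iff L v w hw _).2 ?_
      rw [hYw, map_div₀, Matrix.sub_apply, Pi.sub_apply, hone, ← hent, div_le_iff₀ ((Valuation.pos_iff _).2 h40), one_mul]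
      exact h i j
    · ext i j w'
      rw [Subsingleton.elim w' w]
      rw [Matrix.smul_apply, smul_eq_mul, Pi.mul_apply, Matrix.smul_apply, smul_eq_mul, Pi.mul_apply, hpw, Pi.ofNat_apply, hYw, ← mul_assoc,
        show (2 : w.1.adicCompletion L) * 2 = 4 by norm_num, mul_div_cancel₀ _ h40]

/-! ## §2 (C2b-ii) on the CM carrier: K2E5-p07 (g3)'s `hLad` binder, VERBATIM -/

/-- **(C2b-ii) «LADDER» `[S ∩ K_an : S ∩ K_an(4)] = q^{6m−⌊d∕2⌋}`** — EXACTLY the `hLad` hypothesis of ★ `K2E3WildAnisotropicResidualCountOfParts.anCount_of_struct_of_topIndex_of_ladder`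
(K2E5-p07 (g3)): `L` CM, `w ∣ v` non-split RAMIFIED and DYADIC (`2 ∈ v`), `|2|_v = exp(−m)`, different exponent `d` (`∀ τ` letter), `ξ ∈ L` fixed by `c` with `ξ_w` a unit (the non-norm
clause is carried but not used by the count), `ha` the radius guard, `S` the det-one binder through ★ `localNonsplitEquiv`; conclusion
`(levelOf L 2 ⟨1,−ξ⟩ v 1 (ballMat … p) _ ⊓ S).relIndex (S ⊓ K_v) = #(𝓞_{L⁺}∕v)^(6m − d∕2)`.  Proof: §1 + ★ `relIndex_normOne_level_eq_pow_of_injective` along `Ψ = (↑) ∘ E`.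
[cite: Kottwitz1988, §1 Thm. 1] [cite: Riehm1970, §§1–2] [cite: Serre1979, Ch. V §3 Cor. 3] [cite: Rogawski1990, §3.8 p. 33] [cite: PlatonovRapinchuk1994, §5.1] -/
theorem relIndex_levelOf_inf_normOne_eq_pow :
    ∀ (L : Type) [Field L] [NumberField L] [IsCMField L] (v : HeightOneSpectrum (𝓞 ↥(maximalRealSubfield L)))
      (w : UnitaryGroup.PlacesOver L v) (hw : IsCMField.complexConj L • w.1 = w.1),
      v.asIdeal.ramificationIdx' w.1.asIdeal ≠ 1 → (2 : 𝓞 ↥(maximalRealSubfield L)) ∈ v.asIdeal →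
      ∀ (m d : ℕ), Valued.v (2 : v.adicCompletion ↥(maximalRealSubfield L)) = WithZero.exp (-(m : ℤ)) →
      (∀ τ : w.1.adicCompletion L, Valued.v τ = WithZero.exp (-1 : ℤ) →
        Valued.v (galAdicCompletionMap (L := L) (IsCMField.complexConj L) hw τ - τ) = WithZero.exp (-(d : ℤ))) →
      ∀ (ξ : L), IsCMField.complexConj L ξ = ξ → Valued.v (algebraMap L (w.1.adicCompletion L) ξ) = 1 →
      (¬ ∃ t : w.1.adicCompletion L, t * galAdicCompletionMap (L := L) (IsCMField.complexConj L) hw t = algebraMap L (w.1.adicCompletion L) ξ) →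
      ∀ (ha : ∀ w' : UnitaryGroup.PlacesOver L v, Valued.v (((resChar L v : ℕ) : UnitaryGroup.LocalRing L v) w') < 1)
        (S : Subgroup ((UnitaryGroup.cmDatum L 2 !![(1 : L), 0; 0, -ξ]).Local v)),
      (∀ g : (UnitaryGroup.cmDatum L 2 !![(1 : L), 0; 0, -ξ]).Local v, g ∈ S ↔
        (((localNonsplitEquiv (IsCMField.complexConj L) !![(1 : L), 0; 0, -ξ] (IsCMField.complexConj_ne_one L) w hw g :
            ↥(unitaryGroupOfForm (galAdicCompletionMap (L := L) (IsCMField.complexConj L) hw) (placeForm !![(1 : L), 0; 0, -ξ] w.1))) :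
          GL (Fin 2) (w.1.adicCompletion L)) : Matrix (Fin 2) (Fin 2) (w.1.adicCompletion L)).det = 1) →
      (levelOf L 2 !![(1 : L), 0; 0, -ξ] v 1 (ballMat L 2 v ((resChar L v : ℕ) : UnitaryGroup.LocalRing L v))
              (ballMat_mul_closed L 2 v (mem_localIntegers_of_forall_valued_lt_one L v ha)) ⊓ S).relIndex
            (S ⊓ cmLocalIntegralLevel L 2 !![(1 : L), 0; 0, -ξ] v) =
        Nat.card (𝓞 ↥(maximalRealSubfield L) ⧸ v.asIdeal) ^ (6 * m - d / 2) := by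
  intro L _ _ _ v w hw he h2 m d hm hd ξ hξc hξ1 _ ha S hS
  classical
  have hc1 : IsCMField.complexConj L ≠ 1 := IsCMField.complexConj_ne_one L
  haveI : Algebra.IsQuadraticExtension ↥(maximalRealSubfield L) L := IsCMField.isQuadraticExtension L
  haveI := PlacesOver.subsingleton_of_smul_eq (IsCMField.complexConj L) hc1 w hw
  haveI : Finite 𝓀[w.1.adicCompletion L] := finite_residueField_adicCompletion L w.1
  -- notation-free abbreviations
  have hσσ : ∀ x, galAdicCompletionMap (L := L) (IsCMField.complexConj L) hw (galAdicCompletionMap (L := L) (IsCMField.complexConj L) hw x) = x :=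
    galAdicCompletionMap_galAdicCompletionMap_of_smul_eq (IsCMField.complexConj L) w hc1 hw
  have hvσ : ∀ x, Valued.v (galAdicCompletionMap (L := L) (IsCMField.complexConj L) hw x) = Valued.v x := fun x => by rw [valued_galAdicCompletionMap]
  have hσξ : galAdicCompletionMap (L := L) (IsCMField.complexConj L) hw (algebraMap L (w.1.adicCompletion L) ξ) = algebraMap L (w.1.adicCompletion L) ξ :=
    galAdicCompletionMap_anisoXi L v w hw hξc
  -- the datum with THIS `d`, `t = 2m`, `m ≥ 1`
  obtain ⟨ϖ, hϖ⟩ := exists_valued_eq_exp_neg_one L v w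
  obtain ⟨t, hD⟩ := exists_isRamifiedQuadraticDatum_of_hd L v w hw he hd hϖ
  have hm1 : 1 ≤ m := one_le_of_valued_two_eq L v h2 hm
  have htm : t = 2 * m := by
    have h2w : Valued.v (2 : w.1.adicCompletion L) = WithZero.exp (-(2 * (m : ℤ))) := by
      rw [valued_two_eq_sq_of_ramified L v w hw he, hm, ← WithZero.exp_nsmul]; congr 1; simp only [nsmul_eq_mul]; push_cast; ring
    have ht := hD.2.2.2.2.2.2
    rw [h2w, hϖ, ← WithZero.exp_nsmul, WithZero.exp_inj, nsmul_eq_mul] at ht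
    omega
  have h4 : Valued.v (4 : w.1.adicCompletion L) = WithZero.exp (-((4 * m : ℕ) : ℤ)) := by
    rw [valued_four_eq_of_ramified L v w hw he hm]; push_cast; ring_nf
  have hq : Nat.card 𝓀[w.1.adicCompletion L] = Nat.card (𝓞 ↥(maximalRealSubfield L) ⧸ v.asIdeal) :=
    Literature.NumberTheory.Rogawski1990.natCard_valuedResidueField_eq_of_ramified_CM L v w hw he
  -- the transport `Ψ = (↑) ∘ E`
  obtain ⟨Ψ, hΨ⟩ : ∃ Ψ : (cmDatum L 2 !![(1 : L), 0; 0, -ξ]).Local v →* GL (Fin 2) (w.1.adicCompletion L),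
      ∀ g, Ψ g = (((localNonsplitEquiv (IsCMField.complexConj L) !![(1 : L), 0; 0, -ξ] hc1 w hw) g :
        ↥(unitaryGroupOfForm (galAdicCompletionMap (L := L) (IsCMField.complexConj L) hw) (placeForm !![(1 : L), 0; 0, -ξ] w.1))) :
        GL (Fin 2) (w.1.adicCompletion L)) :=
    ⟨{ toFun := fun g => (((localNonsplitEquiv (IsCMField.complexConj L) !![(1 : L), 0; 0, -ξ] hc1 w hw) g :
          ↥(unitaryGroupOfForm (galAdicCompletionMap (L := L) (IsCMField.complexConj L) hw) (placeForm !![(1 : L), 0; 0, -ξ] w.1))) :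
          GL (Fin 2) (w.1.adicCompletion L))
       map_one' := congrArg Subtype.val (map_one (localNonsplitEquiv (IsCMField.complexConj L) !![(1 : L), 0; 0, -ξ] hc1 w hw))
       map_mul' := fun x y => congrArg Subtype.val (map_mul (localNonsplitEquiv (IsCMField.complexConj L) !![(1 : L), 0; 0, -ξ] hc1 w hw) x y) }, fun _ => rfl⟩
  have hΨinj : Function.Injective Ψ := fun a b h => by
    rw [hΨ, hΨ] at h
    exact (localNonsplitEquiv (IsCMField.complexConj L) !![(1 : L), 0; 0, -ξ] hc1 w hw).injective (Subtype.ext h)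
  have hΨU : ∀ g, Ψ g ∈ unitaryGroupOfForm (galAdicCompletionMap (L := L) (IsCMField.complexConj L) hw)
      !![(1 : w.1.adicCompletion L), 0; 0, -(algebraMap L (w.1.adicCompletion L) ξ)] := fun g => by
    rw [hΨ, ← placeForm_anisoPlane L v w ξ]
    exact ((localNonsplitEquiv (IsCMField.complexConj L) !![(1 : L), 0; 0, -ξ] hc1 w hw) g).2
  have hΨsurj : ∀ u : GL (Fin 2) (w.1.adicCompletion L), u ∈ unitaryGroupOfForm (galAdicCompletionMap (L := L) (IsCMField.complexConj L) hw)
      !![(1 : w.1.adicCompletion L), 0; 0, -(algebraMap L (w.1.adicCompletion L) ξ)] → ∃ g, Ψ g = u := fun u hu => by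
    have hu' : u ∈ unitaryGroupOfForm (galAdicCompletionMap (L := L) (IsCMField.complexConj L) hw) (placeForm !![(1 : L), 0; 0, -ξ] w.1) := by
      rw [placeForm_anisoPlane L v w ξ]; exact hu
    exact ⟨(localNonsplitEquiv (IsCMField.complexConj L) !![(1 : L), 0; 0, -ξ] hc1 w hw).symm ⟨u, hu'⟩, by rw [hΨ, ContinuousMulEquiv.apply_symm_apply]⟩
  -- the det and integrality letters through `Ψ`
  have hSΨ : ∀ g, g ∈ S ↔ ((Ψ g : GL (Fin 2) (w.1.adicCompletion L)) : Matrix (Fin 2) (Fin 2) (w.1.adicCompletion L)).det = 1 := fun g => by rw [hS, hΨ]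
  have hKΨ : ∀ g, ((Ψ g : GL (Fin 2) (w.1.adicCompletion L)) : Matrix (Fin 2) (Fin 2) (w.1.adicCompletion L)).det = 1 →
      (g ∈ cmLocalIntegralLevel L 2 !![(1 : L), 0; 0, -ξ] v ↔ ∀ i j, Valued.v (((Ψ g : GL (Fin 2) (w.1.adicCompletion L)) : Matrix (Fin 2) (Fin 2) (w.1.adicCompletion L)) i j) ≤ 1) := by
    intro g hdet
    refine (mem_localIntegralLevel_iff_of_smul_eq (IsCMField.complexConj L) 2 !![(1 : L), 0; 0, -ξ] hc1 w hw g).trans ?_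
    rw [← hΨ]
    exact mem_glInt_iff_forall_v_le_one_of_v_det_eq_one _ (by rw [hdet, map_one])
  -- THE TWO TRANSPORTED LETTERS
  have hA : ∀ u : GL (Fin 2) (w.1.adicCompletion L), u ∈ (S ⊓ cmLocalIntegralLevel L 2 !![(1 : L), 0; 0, -ξ] v).map Ψ ↔
      ((u : Matrix (Fin 2) (Fin 2) (w.1.adicCompletion L)) 0 1 = algebraMap L (w.1.adicCompletion L) ξ *
          galAdicCompletionMap (L := L) (IsCMField.complexConj L) hw ((u : Matrix (Fin 2) (Fin 2) (w.1.adicCompletion L)) 1 0) ∧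
        (u : Matrix (Fin 2) (Fin 2) (w.1.adicCompletion L)) 1 1 = galAdicCompletionMap (L := L) (IsCMField.complexConj L) hw ((u : Matrix (Fin 2) (Fin 2) (w.1.adicCompletion L)) 0 0) ∧
        Valued.v ((u : Matrix (Fin 2) (Fin 2) (w.1.adicCompletion L)) 0 0) ≤ 1 ∧ Valued.v ((u : Matrix (Fin 2) (Fin 2) (w.1.adicCompletion L)) 1 0) ≤ 1 ∧
        (u : Matrix (Fin 2) (Fin 2) (w.1.adicCompletion L)).det = 1) := by
    intro u
    constructor
    · rintro ⟨g, hg, rfl⟩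
      obtain ⟨hgS, hgK⟩ := Subgroup.mem_inf.1 hg
      have hdet := (hSΨ g).1 hgS
      have hint := (hKΨ g hdet).1 hgK
      obtain ⟨a, b, hab, -⟩ := (mem_unitaryGroupOfForm_and_det_eq_one_iff (galAdicCompletionMap (L := L) (IsCMField.complexConj L) hw)
        (algebraMap L (w.1.adicCompletion L) ξ) hσσ hσξ (Ψ g)).1 ⟨hΨU g, hdet⟩
      refine ⟨?_, ?_, hint 0 0, hint 1 0, hdet⟩
      · rw [hab]; simp [hσσ]
      · rw [hab]; simp
    · rintro ⟨h01, h11, ha0, hc0, hdet⟩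
      have hmem : u ∈ unitaryGroupOfForm (galAdicCompletionMap (L := L) (IsCMField.complexConj L) hw)
          !![(1 : w.1.adicCompletion L), 0; 0, -(algebraMap L (w.1.adicCompletion L) ξ)] :=
        ((mem_unitaryGroupOfForm_and_det_eq_one_iff (galAdicCompletionMap (L := L) (IsCMField.complexConj L) hw) (algebraMap L (w.1.adicCompletion L) ξ) hσσ hσξ u).2
          ⟨(u : Matrix (Fin 2) (Fin 2) (w.1.adicCompletion L)) 0 0, galAdicCompletionMap (L := L) (IsCMField.complexConj L) hw ((u : Matrix (Fin 2) (Fin 2) (w.1.adicCompletion L)) 1 0),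
            by rw [hσσ]; exact eq_of_shape h01 h11, by rw [hσσ, mul_comm (galAdicCompletionMap (L := L) (IsCMField.complexConj L) hw _) ((u : Matrix (Fin 2) (Fin 2) _) 1 0), ← det_of_shape h01 h11, hdet]⟩).1
      obtain ⟨g, hgu⟩ := hΨsurj u hmem
      subst hgu
      refine ⟨g, Subgroup.mem_inf.2 ⟨(hSΨ g).2 hdet, (hKΨ g hdet).2 (valued_apply_le_one_of_shape hvσ hξ1 h01 h11 ha0 hc0)⟩, rfl⟩
  have hB : ∀ u : GL (Fin 2) (w.1.adicCompletion L),
      u ∈ (levelOf L 2 !![(1 : L), 0; 0, -ξ] v 1 (ballMat L 2 v ((resChar L v : ℕ) : LocalRing L v)) (ballMat_mul_closed L 2 v (mem_localIntegers_of_forall_valued_lt_one L v ha)) ⊓ S).map Ψ ↔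
      u ∈ (S ⊓ cmLocalIntegralLevel L 2 !![(1 : L), 0; 0, -ξ] v).map Ψ ∧
        Valued.v ((u : Matrix (Fin 2) (Fin 2) (w.1.adicCompletion L)) 0 0 - 1) ≤ WithZero.exp (-((4 * m : ℕ) : ℤ)) ∧
        Valued.v ((u : Matrix (Fin 2) (Fin 2) (w.1.adicCompletion L)) 1 0) ≤ WithZero.exp (-((4 * m : ℕ) : ℤ)) := by
    intro u
    rw [← h4]
    constructor
    · rintro ⟨g, hg, rfl⟩
      obtain ⟨hgL, hgS⟩ := Subgroup.mem_inf.1 hg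
      have hgK : g ∈ cmLocalIntegralLevel L 2 !![(1 : L), 0; 0, -ξ] v :=
        (Subgroup.mem_inf.1 (levelOf_ballMat_le_inf_level L 2 !![(1 : L), 0; 0, -ξ] v 1 (mem_localIntegers_of_forall_valued_lt_one L v ha) hgL)).2
      obtain ⟨-, hg1, -⟩ := (mem_levelOf_iff L 2 _ v 1 _ _ g).1 hgL
      have hcong := (sub_one_mem_twoBall_ballMat_iff L v w hw h2 !![(1 : L), 0; 0, -ξ] g).1 hg1
      refine ⟨⟨g, Subgroup.mem_inf.2 ⟨hgS, hgK⟩, rfl⟩, ?_, ?_⟩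
      · have h00 := hcong 0 0
        rw [Matrix.one_apply_eq] at h00
        rw [hΨ]; exact h00
      · have h10 := hcong 1 0
        rw [Matrix.one_apply_ne (by decide), sub_zero] at h10
        rw [hΨ]; exact h10
    · rintro ⟨⟨g, hg, rfl⟩, ha4, hc4⟩
      obtain ⟨hgS, hgK⟩ := Subgroup.mem_inf.1 hg
      obtain ⟨h01, h11, -, -, -⟩ := (hA (Ψ g)).1 ⟨g, hg, rfl⟩
      have h101 : (1 : Matrix (Fin 2) (Fin 2) (w.1.adicCompletion L)) 0 1 =
          algebraMap L (w.1.adicCompletion L) ξ * galAdicCompletionMap (L := L) (IsCMField.complexConj L) hw ((1 : Matrix (Fin 2) (Fin 2) (w.1.adicCompletion L)) 1 0) := by simp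
      have h111 : (1 : Matrix (Fin 2) (Fin 2) (w.1.adicCompletion L)) 1 1 =
          galAdicCompletionMap (L := L) (IsCMField.complexConj L) hw ((1 : Matrix (Fin 2) (Fin 2) (w.1.adicCompletion L)) 0 0) := by simp
      have hall : ∀ i j, Valued.v ((((Ψ g : GL (Fin 2) (w.1.adicCompletion L)) : Matrix (Fin 2) (Fin 2) (w.1.adicCompletion L)) - 1) i j) ≤ Valued.v (4 : w.1.adicCompletion L) :=
        (valued_sub_apply_le_iff_of_shape hvσ hξ1 h01 h11 h101 h111).2
          ⟨by rw [Matrix.one_apply_eq]; exact ha4, by rw [Matrix.one_apply_ne (by decide), sub_zero]; exact hc4⟩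
      have hg1 : mat L 2 !![(1 : L), 0; 0, -ξ] v g - 1 ∈ twoBall L 2 v (ballMat L 2 v ((resChar L v : ℕ) : LocalRing L v)) := by
        refine (sub_one_mem_twoBall_ballMat_iff L v w hw h2 !![(1 : L), 0; 0, -ξ] g).2 fun i j => ?_
        have h := hall i j
        rw [Matrix.sub_apply, hΨ] at h
        exact h
      refine ⟨g, Subgroup.mem_inf.2 ⟨(mem_levelOf_iff L 2 _ v 1 _ _ g).2 ⟨?_, hg1, ?_⟩, hgS⟩, rfl⟩
      · exact Subgroup.mem_centralizer_iff.2 fun h hh => by rw [Set.mem_singleton_iff.1 hh, one_mul, mul_one]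
      · rw [twoBall_ballMat] at hg1 ⊢
        exact mat_inv_sub_one_mem_ballMat L 2 !![(1 : L), 0; 0, -ξ] v hgK hg1
  rw [← hq]
  exact relIndex_normOne_level_eq_pow_of_injective hD htm hm1 hσξ hξ1 hΨinj hA hB

end Summit.HodgeConjecture.HodgeConjecture.Cruxes.H413.K2E3WildOrderNormOneLevelCountPlace

end
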